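import Summits.CriticalPhenomena.PercolationContinuityZ3.Theorems.PercNearOneGluingNoHeavyQuantHighConv
import HarnessLib

/-!
# QUANT lane R8, T-DEC: **ONE HULL+HIGH SIBLING, OR ONE TAME SIBLING, IS FREE ON THE NODE'S BINDER** — a hull+high decomposable sibling (census-1 g29)
# can be adjoined to ANY SDEC forest; with the oracle, a forest containing at least one hull+high OR tame sibling is SDEC (arm-1 gen 57)

builds on p205010 (kernel theorem, internal audit signed; external expert review pending)

Support file (`--supports stmt-CriticalPhenomena-4575`), QUANT lane seat prim-quant-arm-1 (gen 57, architect); memo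
`run/shared/lean/prim/quant/prim-quant-arm-1-g57/ARCH-G57.md`.  Theorems only; standard axioms, no sorries.

WHAT.  prim-quant-census-1 g29's hull+high criterion (`sdec_flaw_of_hullHigh`: a forest ALL of whose gated siblings are hull+high decomposable —
`HullHigh x (q·mean) M (gate ρ q)`: a same-mean mixture of (HIGH law) ∗ (independent heavy blobs) — is SDEC, no oracle) and arm-1 g56/g57's tame criterion
(`sdec_cons_of_tame`, ✓ `…QuantCompSlice`) are joined at the node: **`sdec_cons_of_hullHigh`** — a hull+high sibling can be adjoined to ANY SDEC forest of law-OK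
affordable siblings (components: HIGH-CONV `sdec_lconv_high` ✓ `…QuantHighConv`, then the blob slice `sdec_lconv_blobLaw` (census-1 g28 on CW), re-associated by
`lconv_assoc`; mixture by census-2's `sdec_of_gatedSDECMixture` with unit gates); **`sdec_siblings_of_hullHigh`** / **`sdec_siblings_of_tame'`** — on the node's
list binder with the oracle below the gate budget, a tree-OK forest containing AT LEAST ONE hull+high (resp. tame) sibling ANYWHERE in the list is SDEC
(permutation invariance `flaw_perm`/`ftop_perm`/`fgates_perm`).  So `SiblingStep` owes only forests EVERY sibling of which is neither tame nor hull+high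
(the far-giant / near-sure corner).

* **`sdec_cons_of_hullHigh`**, `sdec_siblings_of_cons_criterion` (the permutation bookkeeping, for any adjoinable criterion),
  **`sdec_siblings_of_hullHigh`**, **`sdec_siblings_of_tame'`**.

HONEST STATUS.  `SiblingStep` / `GateStepN` / `LightResidDECOracle` / `FarTreeRow` OPEN; RATE class (log\*) / honest sentence of
`run/shared/lean/prim/quant/README.md` unchanged.  [this work]; hull+high: census-1 g29; blob slice: census-1 g28 / CW; mixtures: census-2.  Nothing here is cited as
a published result.  The gluing rows served [cite: KozmaNitzan2024, Conjecture 3 (p. 15)]; product measure [cite: Grimmett1999, §1.3 p. 10].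
-/

noncomputable section

open scoped BigOperators

namespace Summit.CriticalPhenomena.PercolationContinuityZ3.Theorems
namespace Quant
namespace LawDec

open Finset

/-- **ADJOINING A HULL+HIGH SIBLING TO ANY SDEC FOREST.**  `L` law-OK siblings with per-sibling affordability and `SDEC x (ftop L) (flaw L)` (from anywhere),
`s` a sibling whose gated law is hull+high decomposable at `x` with its mean (`HullHigh x (s.q·s.mean) s.M (gate s.ρ s.q)`) ⟹
`SDEC x (ftop (s :: L)) (flaw (s :: L))`. [this work] -/
theorem sdec_cons_of_hullHigh {x : ℝ} (hx0 : 0 < x) (hx1 : x < 1) (L : List Sib) (s : Sib)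
    (hL : ∀ t ∈ L, t.LawOK) (hxL : ∀ t ∈ L, x * (t.M : ℝ) ≤ t.q * t.mean) (hS : SDEC x (ftop L) (flaw L))
    (hs : HullHigh x (s.q * s.mean) s.M (gate s.ρ s.q)) :
    SDEC x (ftop (s :: L)) (flaw (s :: L)) := by
  classical
  obtain ⟨f0, fM, f1, fmn⟩ := flaw_facts L hL
  have hta : x * (ftop L : ℝ) ≤ ∑ h ∈ Finset.range (ftop L + 1), (h : ℝ) * flaw L h := by
    rw [fmn]; exact floor_ftop_le_fmean' x L hxL
  obtain ⟨_, _, t1, tmn⟩ := hs.lawFacts hx0.le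
  obtain ⟨ι, hι, w, mH, MH, H, l, hw0, hw1, hH, hg, htop, hmean, hmix⟩ := hs
  set F : ℕ := ftop L with hFdef
  -- the components `(flaw L ∗ Hᵢ) ∗ blobLaw lᵢ`, declared on their own tops
  have C := fun i => hullHigh_comp_facts hx0.le (hH i) (l i) (hg i) le_rfl
  set P : ι → ℕ → ℝ := fun i => lconv F (MH i + blobTop (l i)) (flaw L) (lconv (MH i) (blobTop (l i)) (H i) (blobLaw (l i))) with hP
  show SDEC x (F + s.M) (lconv F s.M (flaw L) (gate s.ρ s.q))
  refine sdec_of_gatedSDECMixture x (F + s.M) _ w (fun _ => 1) (fun i => F + (MH i + blobTop (l i))) P hx0 hw0 hw1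
    (fun _ => ⟨hx1, le_rfl⟩) (fun i k => lconv_nonneg _ _ _ _ f0 (C i).1 k) (fun i k hk => lconv_eq_zero _ _ _ _ k hk)
    (fun i => sum_lconv _ _ _ _ f1 (C i).2.2.1) (fun i => ?_) (fun i => ?_) (fun i => Nat.add_le_add_left (htop i) F) (fun i => ?_)
    (fun k => ?_)
  · -- affordability of the component
    have h2 := (C i).2.2.2.2
    rw [div_one, sum_mul_lconv _ _ _ _ f1 (C i).2.2.1, (C i).2.2.2.1]
    have e : (((F + (MH i + blobTop (l i)) : ℕ) : ℝ)) = (F : ℝ) + ((MH i + blobTop (l i) : ℕ) : ℝ) := by push_cast; ring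
    rw [e, mul_add]
    exact add_le_add hta h2
  · -- SDEC of the component: HIGH-CONV, then the heavy blobs, re-associated
    rw [div_one]
    obtain ⟨a0, aM, a1, amean, _, ata⟩ := hH i
    have hD := sdec_lconv_high hx0 hx1 (hH i) f0 fM f1 hta hS
    rw [lconv_comm, Nat.add_comm] at hD
    -- facts of `D = flaw L ∗ Hᵢ`
    have D0 : ∀ k, 0 ≤ lconv F (MH i) (flaw L) (H i) k := lconv_nonneg _ _ _ _ f0 a0
    have DM : ∀ k, F + MH i < k → lconv F (MH i) (flaw L) (H i) k = 0 := fun k hk => lconv_eq_zero _ _ _ _ k hk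
    have D1 : ∑ k ∈ Finset.range (F + MH i + 1), lconv F (MH i) (flaw L) (H i) k = 1 := sum_lconv _ _ _ _ f1 a1
    have Dmn : ∑ k ∈ Finset.range (F + MH i + 1), (k : ℝ) * lconv F (MH i) (flaw L) (H i) k = fmean L + mH i := by
      rw [sum_mul_lconv _ _ _ _ f1 a1, fmn, amean]
    have Dta : x * ((F + MH i : ℕ) : ℝ) ≤ ∑ k ∈ Finset.range (F + MH i + 1), (k : ℝ) * lconv F (MH i) (flaw L) (H i) k := by
      rw [Dmn]; push_cast
      have : x * (F : ℝ) ≤ fmean L := by rw [← fmn]; exact hta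
      linarith
    have hE := sdec_lconv_blobLaw hx0 hx1 D0 DM D1 Dta hD (l i) (hg i)
    show SDEC x (F + (MH i + blobTop (l i)))
      (lconv F (MH i + blobTop (l i)) (flaw L) (lconv (MH i) (blobTop (l i)) (H i) (blobLaw (l i))))
    rw [lconv_assoc, ← Nat.add_assoc]
    exact hE
  · -- the common mean `fmean L + q·mean`
    rw [one_mul, sum_mul_lconv _ _ _ _ f1 (C i).2.2.1, (C i).2.2.2.1, hmean i, sum_mul_lconv _ _ _ _ f1 t1, tmn]
  · -- the mixture identity
    simp_rw [gate_one]
    have et : gate s.ρ s.q = fun k => ∑ i, w i * lconv (MH i) (blobTop (l i)) (H i) (blobLaw (l i)) k := funext hmix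
    rw [et, lconv_sum_right]
    refine Finset.sum_congr rfl fun i _ => ?_
    rw [hP, lconv_top_right_of_le F (MH i + blobTop (l i)) s.M (flaw L) _ (htop i) (C i).2.1 k]

/-! ### On the node's binder: one such sibling anywhere in the list -/

/-- bookkeeping: a permutation moving the chosen sibling to the front, with the tree-OK facts and the oracle transported. [this work] -/
theorem sdec_siblings_of_cons_criterion {x : ℝ} (hx0 : 0 < x) (L : List Sib) (hL : ∀ s ∈ L, s.TreeOK x)
    (hO : ∀ (x' : ℝ) (n' M' : ℕ) (μ' : ℕ → ℝ), n' < fgates L → TreeBuiltN x' n' M' μ' → SDEC x' M' μ')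
    (P : Sib → Prop)
    (hstep : ∀ (R : List Sib) (s : Sib), x < 1 → (∀ t ∈ R, t.TreeOK x) → s.TreeOK x → SDEC x (ftop R) (flaw R) → P s →
      SDEC x (ftop (s :: R)) (flaw (s :: R)))
    (hex : ∃ s ∈ L, P s) : SDEC x (ftop L) (flaw L) := by
  obtain ⟨s, hs, hPs⟩ := hex
  obtain ⟨S, T, rfl⟩ := List.append_of_mem hs
  have hperm : (S ++ s :: T).Perm (s :: (S ++ T)) := List.perm_middle
  rw [flaw_perm hperm, ftop_perm hperm]
  rw [fgates_perm hperm] at hO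
  have hL' : ∀ t ∈ S ++ T, t.TreeOK x := fun t ht => by
    refine hL t ?_
    rw [List.mem_append] at ht ⊢
    rcases ht with ht | ht
    · exact Or.inl ht
    · exact Or.inr (List.mem_cons_of_mem s ht)
  have hsT : s.TreeOK x := hL s (List.mem_append_right S List.mem_cons_self)
  obtain ⟨hq0, hq1, hxq, hT, _⟩ := hL s (List.mem_append_right S List.mem_cons_self)
  obtain ⟨_, hx₁1, _, _, _, _⟩ := hT.lawFacts
  have hx1 : x < 1 := (lt_of_le_of_lt hxq (by nlinarith)).trans hq1
  have hF : TreeBuiltN x (fgates (S ++ T)) (ftop (S ++ T)) (flaw (S ++ T)) := (compForestN_of_list hx0 hx1 (S ++ T) hL').treeBuiltN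
  have hSF : SDEC x (ftop (S ++ T)) (flaw (S ++ T)) := hO x _ _ _ (by simp only [fgates]; omega) hF
  exact hstep (S ++ T) s hx1 hL' hsT hSF hPs

/-- **THE NODE FOR FORESTS WITH A HULL+HIGH SIBLING, GIVEN THE ORACLE**: tree-OK siblings `L` at `0 < x`, the oracle below the gate budget `fgates L`, and SOME
sibling of `L` with a hull+high decomposable gated law ⟹ `SDEC x (ftop L) (flaw L)`. [this work] -/
theorem sdec_siblings_of_hullHigh {x : ℝ} (hx0 : 0 < x) (L : List Sib) (hL : ∀ s ∈ L, s.TreeOK x)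
    (hO : ∀ (x' : ℝ) (n' M' : ℕ) (μ' : ℕ → ℝ), n' < fgates L → TreeBuiltN x' n' M' μ' → SDEC x' M' μ')
    (hex : ∃ s ∈ L, HullHigh x (s.q * s.mean) s.M (gate s.ρ s.q)) : SDEC x (ftop L) (flaw L) :=
  sdec_siblings_of_cons_criterion hx0 L hL hO (fun s => HullHigh x (s.q * s.mean) s.M (gate s.ρ s.q))
    (fun R s hx1 hR _ hSR hPs => sdec_cons_of_hullHigh hx0 hx1 R s (fun t ht => (hR t ht).lawOK) (fun t ht => (hR t ht).afford) hSR hPs) hex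

/-- **THE NODE FOR FORESTS WITH A TAME SIBLING, GIVEN THE ORACLE** (symmetric form of `sdec_siblings_of_tame`, ✓ `…QuantCompSlice`): tree-OK siblings `L`,
the oracle below `fgates L`, and SOME sibling of `L` tame at `x` ⟹ `SDEC x (ftop L) (flaw L)`. [this work] -/
theorem sdec_siblings_of_tame' {x : ℝ} (hx0 : 0 < x) (L : List Sib) (hL : ∀ s ∈ L, s.TreeOK x)
    (hO : ∀ (x' : ℝ) (n' M' : ℕ) (μ' : ℕ → ℝ), n' < fgates L → TreeBuiltN x' n' M' μ' → SDEC x' M' μ')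
    (hex : ∃ s ∈ L, ∀ h : ℕ, 1 ≤ h → s.ρ h ≠ 0 → s.q * s.mean ≤ 2 * h ∨ x * ((s.M : ℝ) - h) ≤ s.q * s.mean - h) :
    SDEC x (ftop L) (flaw L) :=
  sdec_siblings_of_cons_criterion hx0 L hL hO
    (fun s => ∀ h : ℕ, 1 ≤ h → s.ρ h ≠ 0 → s.q * s.mean ≤ 2 * h ∨ x * ((s.M : ℝ) - h) ≤ s.q * s.mean - h)
    (fun R s hx1 hR hs hSR hPs => sdec_cons_of_tame hx0 hx1 R s (fun t ht => (hR t ht).lawOK) (fun t ht => (hR t ht).afford) hSR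
      hs.lawOK hs.afford hPs) hex

end LawDec
end Quant
end Summit.CriticalPhenomena.PercolationContinuityZ3.Theorems
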